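import Mathlib
import HarnessLib
import Summits.HubbardSuperconductivity.HubbardSuperconductivity.Theorems.KLProgrammeC4aLevelDensityRadialVertex
import Summits.HubbardSuperconductivity.HubbardSuperconductivity.Theorems.KLProgrammeC4aPartnerBandCooperDefect
import Summits.HubbardSuperconductivity.HubbardSuperconductivity.Theorems.KLProgrammeC4aCoMovingBridge

/-!
# Route `KLProgramme` — crux C4a, S3 brick (B4) «(U1)-LAWS» part 7: the FAR BOX — a box whose partner band stays `≥ d₁` away from the Fermi level costs
# `∫_W F ≤ (β−α)·2hi·(φb−φa)·W·X₀·4/d₁²` by the envelopes alone (no fold structure, no law, no integrability)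

Cell `gate-hubbard-kl`, seat hubbard-kl-k3c3-p3 (g32; row «implicit-function / monotonicity route for μ(n)»).  Located brick for the (C)-closer lane / the (M4)
assembly of the umklapp first-order ϑ-layer (stub (C) `stub_twoLeg_curvature` of `KLRegimeEngineV17F2`, stmt-HubbardSuperconductivity-20437), memo
HOME/hubbard-kl-k3c3-p3/U1-CAUSTIC-SUP.md §13 (the boxes WITHOUT a near-caustic witness, far branch).

WHY.  The (M4) dispatch per box `W × V = [α,β]_ϑ × [φa,φb]_loop` has three branches: NEAR-CAUSTIC (part 6 `foldBox_law_rows` + the cover theorem), TRANSVERSAL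
umklapp crossing (the monotone-window calculus of B4-GEN-WINDOW), and FAR: the level-`0` partner band satisfies `|e_K(S(ϑ) − Φ(0,v+θ))| ≥ d₁` on the whole box.  In the far
branch nothing cancels and nothing needs to: for loop levels `|e| ≤ hi` with `K₁·hi/(Dt−2A) ≤ d₁/2` the partner level stays `≥ d₁/2` in absolute value (the band is
`K₁`-Lipschitz, the chart moves by `|e|/(Dt−2A)` radially — `…C4aPartnerBandCooperDefect.abs_frameLevel_sub_le`, `…C4aLevelDensityRadialVertex.norm_levelPoint_sub_levelPoint_le`),
so the envelopes `|(K e)′u| ≤ 1/max(|e|,|u|)²` (`e ≠ 0`) and `1/max(lo,|u|)²` (`|e| ≤ lo`) give `|(K e)′(ē)| ≤ 4/d₁²` pointwise, and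
`F(ϑ) = |∫_{−hi}^{hi}∫_{φa}^{φb} w·X·(K e)′(ē)| ≤ 2hi·(φb−φa)·W·X₀·4/d₁²` — pointwise × length twice, then × `(β − α)`.
* **`farBox_pointwise_le`** and **`farBox_integral_le`** (HEADLINE).
Sizes binder shape; nothing asserts (C), K3 or superconductivity.
References: FST II CPAM 51 (1998) §3 [cite: FeldmanSalmhoferTrubowitz1998]; Salmhofer 1999 §4.5.3 [cite: Salmhofer1999].
-/

noncomputable section

namespace Summit.HubbardSuperconductivity.HubbardSuperconductivity.Theorems.C4a

set_option linter.dupNamespace false -- summit = problem name (single-conjunct summit), D-0017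

open Real Set MeasureTheory intervalIntegral
open scoped Interval
open Literature.MathematicalPhysics.QuantumLattice Literature.MathematicalPhysics.QuantumLattice.BandSectorCounting
open Literature.MathematicalPhysics.QuantumLattice.FermiRG
open Summit.HubbardSuperconductivity.HubbardSuperconductivity.Theorems.KLRegimeSplit
open Summit.HubbardSuperconductivity.HubbardSuperconductivity.Theorems.DispersionFlow
open Summit.HubbardSuperconductivity.HubbardSuperconductivity.Theorems.PerturbedFermiCurve

section Sizes

variable {K : TrigPolyC4v} {A : ℝ} (hA : ∀ p : Momentum, ∀ j ≤ 2, ‖iteratedFDeriv ℝ j (frameShift K) p‖ ≤ A) (hA20 : A ≤ 1 / 20)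
  (hd : klCurveD ≤ (bandBounds (show (-4 : ℝ) < -1.1 by norm_num) (show (-1.1 : ℝ) ≤ -0.1 by norm_num)
    (show (-0.1 : ℝ) < 0 by norm_num)).Dtmin - 2 * A)
  {μ r : ℝ} (hr : 0 < r) (hlo : (-1.1 : ℝ) < μ - r - A) (hhi : μ + r + A < -0.1)
  {K₁ : ℝ} (hK₁ : ∀ p : Momentum, ‖fderiv ℝ (frameLevel μ K) p‖ ≤ K₁)
include hA hA20 hd hr hlo hhi hK₁

omit hA20 in
/-- **THE FAR BOX, POINTWISE IN `ϑ`.**  Box `[α,β] × [φa,φb]`; levels `0 < lo`, `0 ≤ hi < r` with `K₁·hi/(Dt−2A) ≤ d₁/2`; the level-`0` partner band is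
`≥ d₁` in absolute value on the box; kernel envelopes off and on the strip; `|X| ≤ X₀`, `0 ≤ w ≤ W`.  THEN for every `ϑ ∈ [α,β]`:
`|∫_{−hi..hi} ∫_{φa..φb} w(e)·(X(e,v)·(K e)′(e_K(S(ϑ) − Φ(e,v+θ)))) dv de| ≤ 2hi·((φb − φa)·(W·X₀·(4/d₁²)))`. -/
theorem farBox_pointwise_le (ρ θ : ℝ) {α β φa φb lo hi d₁ X₀ W : ℝ} {Kr X : ℝ → ℝ → ℝ} {wt : ℝ → ℝ}
    (hφ : φa ≤ φb) (hlo0 : 0 < lo) (hhi0 : 0 ≤ hi) (hhir : hi < r) (hd₁ : 0 < d₁)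
    (hhid : K₁ * (hi / ((bandBounds (show (-4 : ℝ) < -1.1 by norm_num) (show (-1.1 : ℝ) ≤ -0.1 by norm_num) (show (-0.1 : ℝ) < 0 by norm_num)).Dtmin - 2 * A)) ≤ d₁ / 2)
    (hfar : ∀ ϑ ∈ Icc α β, ∀ v ∈ Icc φa φb, d₁ ≤ |frameLevel μ K (pairSumPath μ K ρ ϑ θ 0 - levelPoint μ K 0 (v + θ))|)
    (hK1 : ∀ e ∈ Icc (-hi) hi, e ≠ 0 → ∀ u, |deriv (Kr e) u| ≤ (max |e| |u|)⁻¹ ^ 2)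
    (hKs1 : ∀ e ∈ Icc (-lo) lo, ∀ u, |deriv (Kr e) u| ≤ (max lo |u|)⁻¹ ^ 2)
    (hXb : ∀ e ∈ Icc (-hi) hi, ∀ v ∈ Icc φa φb, |X e v| ≤ X₀) (hw0 : ∀ e ∈ Icc (-hi) hi, 0 ≤ wt e) (hwW : ∀ e ∈ Icc (-hi) hi, wt e ≤ W)
    {ϑ : ℝ} (hϑ : ϑ ∈ Icc α β) :
    |∫ e in (-hi)..hi, ∫ v in φa..φb, wt e * (X e v * deriv (Kr e) (frameLevel μ K (pairSumPath μ K ρ ϑ θ 0 - levelPoint μ K e (v + θ))))| ≤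
      2 * hi * ((φb - φa) * (W * X₀ * (4 / d₁ ^ 2))) := by
  set B := bandBounds (show (-4 : ℝ) < -1.1 by norm_num) (show (-1.1 : ℝ) ≤ -0.1 by norm_num) (show (-0.1 : ℝ) < 0 by norm_num) with hBdef
  have hADt : 2 * A < B.Dtmin := by have := klCurveD_pos; linarith
  have hDt : 0 < B.Dtmin - 2 * A := by linarith
  have hK₁0 : 0 ≤ K₁ := (norm_nonneg _).trans (hK₁ 0)
  have hhh : -hi ≤ hi := by linarith
  have h0I : (0 : ℝ) ∈ Icc (-hi) hi := ⟨by linarith, hhi0⟩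
  have hX00 : 0 ≤ X₀ := by
    rcases hϑ with _
    exact (abs_nonneg _).trans (hXb 0 h0I φa (left_mem_Icc.2 hφ))
  have hW0 : 0 ≤ W := (hw0 0 h0I).trans (hwW 0 h0I)
  set S : Momentum := pairSumPath μ K ρ ϑ θ 0 with hS
  -- the partner level along the box stays `≥ d₁/2`
  have hlevel : ∀ e ∈ Icc (-hi) hi, ∀ v ∈ Icc φa φb, d₁ / 2 ≤ |frameLevel μ K (S - levelPoint μ K e (v + θ))| := fun e he v hv => by
    have heI : e ∈ Ioo (-r) r := ⟨by linarith [he.1], lt_of_le_of_lt he.2 hhir⟩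
    have h0r : (0 : ℝ) ∈ Ioo (-r) r := ⟨by linarith, hr⟩
    have h1 := abs_frameLevel_sub_le hK₁ (S - levelPoint μ K e (v + θ)) (S - levelPoint μ K 0 (v + θ))
    have h2 : ‖(S - levelPoint μ K e (v + θ)) - (S - levelPoint μ K 0 (v + θ))‖ = ‖levelPoint μ K e (v + θ) - levelPoint μ K 0 (v + θ)‖ := by
      rw [show (S - levelPoint μ K e (v + θ)) - (S - levelPoint μ K 0 (v + θ)) = -(levelPoint μ K e (v + θ) - levelPoint μ K 0 (v + θ)) by abel, norm_neg]
    have h3 := norm_levelPoint_sub_levelPoint_le B hA hADt hlo hhi heI h0r (v + θ)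
    rw [sub_zero] at h3
    have h4 : K₁ * ‖levelPoint μ K e (v + θ) - levelPoint μ K 0 (v + θ)‖ ≤ d₁ / 2 := by
      refine le_trans (mul_le_mul_of_nonneg_left (h3.trans ?_) hK₁0) hhid
      exact div_le_div_of_nonneg_right (abs_le.2 ⟨by linarith [he.1], he.2⟩) hDt.le
    rw [h2] at h1
    have h5 := hfar ϑ hϑ v hv
    have h6 := abs_sub_abs_le_abs_sub (frameLevel μ K (S - levelPoint μ K 0 (v + θ))) (frameLevel μ K (S - levelPoint μ K e (v + θ)))
    rw [abs_sub_comm] at h6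
    linarith
  -- the kernel along the box is at most `4/d₁²`
  have hker : ∀ e ∈ Icc (-hi) hi, ∀ v ∈ Icc φa φb, |deriv (Kr e) (frameLevel μ K (S - levelPoint μ K e (v + θ)))| ≤ 4 / d₁ ^ 2 := fun e he v hv => by
    set u := frameLevel μ K (S - levelPoint μ K e (v + θ)) with hu
    have hul := hlevel e he v hv
    have hu0 : 0 < |u| := lt_of_lt_of_le (by positivity) hul
    have hinv : (|u| ^ 2)⁻¹ ≤ 4 / d₁ ^ 2 := by
      rw [show (4 : ℝ) / d₁ ^ 2 = ((d₁ / 2) ^ 2)⁻¹ by field_simp; norm_num]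
      exact inv_anti₀ (by positivity) (pow_le_pow_left₀ (by positivity) hul 2)
    rcases eq_or_ne e 0 with h0 | h0
    · have h := hKs1 e ⟨by rw [h0]; linarith, by rw [h0]; exact hlo0.le⟩ u
      refine h.trans (le_trans ?_ hinv)
      rw [inv_pow]
      exact inv_anti₀ (pow_pos hu0 2) (pow_le_pow_left₀ (abs_nonneg _) (le_max_right _ _) 2)
    · have h := hK1 e he h0 u
      refine h.trans (le_trans ?_ hinv)
      rw [inv_pow]
      exact inv_anti₀ (pow_pos hu0 2) (pow_le_pow_left₀ (abs_nonneg _) (le_max_right _ _) 2)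
  -- pointwise × length, twice
  have hpt : ∀ e ∈ Ι (-hi) hi, ‖∫ v in φa..φb, wt e * (X e v * deriv (Kr e) (frameLevel μ K (S - levelPoint μ K e (v + θ))))‖ ≤
      W * X₀ * (4 / d₁ ^ 2) * |φb - φa| := fun e he => by
    rw [uIoc_of_le hhh] at he
    have heI : e ∈ Icc (-hi) hi := Ioc_subset_Icc_self he
    refine intervalIntegral.norm_integral_le_of_norm_le_const fun v hv => ?_
    rw [uIoc_of_le hφ] at hv
    have hvI : v ∈ Icc φa φb := Ioc_subset_Icc_self hv
    rw [Real.norm_eq_abs, abs_mul, abs_mul, abs_of_nonneg (hw0 e heI)]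
    have h1 : |X e v| * |deriv (Kr e) (frameLevel μ K (S - levelPoint μ K e (v + θ)))| ≤ X₀ * (4 / d₁ ^ 2) :=
      mul_le_mul (hXb e heI v hvI) (hker e heI v hvI) (abs_nonneg _) hX00
    calc wt e * (|X e v| * |deriv (Kr e) (frameLevel μ K (S - levelPoint μ K e (v + θ)))|) ≤ W * (X₀ * (4 / d₁ ^ 2)) :=
          mul_le_mul (hwW e heI) h1 (by positivity) hW0
      _ = W * X₀ * (4 / d₁ ^ 2) := by ring
  have h := intervalIntegral.norm_integral_le_of_norm_le_const hpt
  rw [Real.norm_eq_abs, abs_of_nonneg (by linarith : (0 : ℝ) ≤ φb - φa), show |hi - -hi| = 2 * hi by rw [abs_of_nonneg (by linarith)]; ring] at h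
  refine h.trans (le_of_eq ?_)
  ring

omit hA20 in
/-- **THE FAR BOX** (HEADLINE): under the hypotheses of `farBox_pointwise_le` with `α ≤ β`,
`∫_{α..β} |∫_{−hi..hi} ∫_{φa..φb} w·(X·(K e)′(ē))| dϑ ≤ (β − α)·(2hi·((φb − φa)·(W·X₀·(4/d₁²))))` — no fold structure, no law, no integrability hypothesis. -/
theorem farBox_integral_le (ρ θ : ℝ) {α β φa φb lo hi d₁ X₀ W : ℝ} {Kr X : ℝ → ℝ → ℝ} {wt : ℝ → ℝ}
    (hαβ : α ≤ β) (hφ : φa ≤ φb) (hlo0 : 0 < lo) (hhi0 : 0 ≤ hi) (hhir : hi < r) (hd₁ : 0 < d₁)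
    (hhid : K₁ * (hi / ((bandBounds (show (-4 : ℝ) < -1.1 by norm_num) (show (-1.1 : ℝ) ≤ -0.1 by norm_num) (show (-0.1 : ℝ) < 0 by norm_num)).Dtmin - 2 * A)) ≤ d₁ / 2)
    (hfar : ∀ ϑ ∈ Icc α β, ∀ v ∈ Icc φa φb, d₁ ≤ |frameLevel μ K (pairSumPath μ K ρ ϑ θ 0 - levelPoint μ K 0 (v + θ))|)
    (hK1 : ∀ e ∈ Icc (-hi) hi, e ≠ 0 → ∀ u, |deriv (Kr e) u| ≤ (max |e| |u|)⁻¹ ^ 2)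
    (hKs1 : ∀ e ∈ Icc (-lo) lo, ∀ u, |deriv (Kr e) u| ≤ (max lo |u|)⁻¹ ^ 2)
    (hXb : ∀ e ∈ Icc (-hi) hi, ∀ v ∈ Icc φa φb, |X e v| ≤ X₀) (hw0 : ∀ e ∈ Icc (-hi) hi, 0 ≤ wt e) (hwW : ∀ e ∈ Icc (-hi) hi, wt e ≤ W) :
    ∫ ϑ in α..β, |∫ e in (-hi)..hi, ∫ v in φa..φb, wt e * (X e v * deriv (Kr e) (frameLevel μ K (pairSumPath μ K ρ ϑ θ 0 - levelPoint μ K e (v + θ))))| ≤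
      (β - α) * (2 * hi * ((φb - φa) * (W * X₀ * (4 / d₁ ^ 2)))) := by
  have hpt : ∀ ϑ ∈ Ι α β, ‖|∫ e in (-hi)..hi, ∫ v in φa..φb, wt e * (X e v * deriv (Kr e) (frameLevel μ K (pairSumPath μ K ρ ϑ θ 0 - levelPoint μ K e (v + θ))))|‖ ≤
      2 * hi * ((φb - φa) * (W * X₀ * (4 / d₁ ^ 2))) := fun ϑ hϑ => by
    rw [uIoc_of_le hαβ] at hϑ
    rw [Real.norm_eq_abs, abs_abs]
    exact farBox_pointwise_le hA hd hr hlo hhi hK₁ ρ θ hφ hlo0 hhi0 hhir hd₁ hhid hfar hK1 hKs1 hXb hw0 hwW (Ioc_subset_Icc_self hϑ)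
  have h := intervalIntegral.norm_integral_le_of_norm_le_const hpt
  rw [Real.norm_eq_abs, abs_of_nonneg (sub_nonneg.2 hαβ)] at h
  refine (le_abs_self _).trans (h.trans (le_of_eq ?_))
  ring

end Sizes

end Summit.HubbardSuperconductivity.HubbardSuperconductivity.Theorems.C4a

end
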